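import Literature.NumberTheory.Automorphic.Liu2021.AppendixC.OmegaHomIsotypic
import Literature.NumberTheory.Automorphic.Liu2021.AppendixC.EtaleH1LevelSemisimple
import Literature.NumberTheory.Automorphic.Liu2021.AppendixC.RestOneLevelInvariants
import Literature.NumberTheory.Automorphic.HeckeFixedVectorsIntertwinersSemilinearLevelwise
import HarnessLib

/-!
# [Liu 2021, p. 133 (D.3)] Hecke-equivariant images of `ω^K` are block values — LEVELWISE edition (semisimplicity of the level-`K′`
# Hecke modules `ℚ̄_ℓ ⊗ H¹_ét(A_{K′})` instead of `G`-level semisimplicity of `ℚ̄_ℓ ⊗ H¹_ét(A_∞)`)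

Topic `NumberTheory/Automorphic/Liu2021/AppendixC`; namespace `Literature.NumberTheory.Automorphic.Liu2021.AppendixC.Sec42Data.HeckeTranslates`.
THEOREMS ONLY (no definition, no named fact, no instance, no `sorry`).  LEVELWISE twin of ★ `OmegaHomIsotypic` (A-p05 (g12)): there the
extension «Hecke-equivariant `L : ω^K → (ℚ̄_ℓ ⊗ H¹_ét(A_∞))^K` is the restriction of an element of `Hom_𝔾(ι_ℓ ∘ ω, ℚ̄_ℓ ⊗ H¹_ét(A_∞))`» is proved
from the `G`-LEVEL binder `[σ.IsSemisimpleRepresentation]` (the (D.3) sentence for the whole tower); here it is proved from the LEVEL-WISE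
hypothesis «for every small level `K′`, `M_{K′} := ℚ̄_ℓ ⊗ H¹_ét(A_{K′})` is a semisimple module over `𝒜_{K′} = ℚ̄_ℓ[ᵗV_ℓ^ℚ(heckeEnd K′ g) ⊗ 1]`»
(which is what a semisimple `heckeImage K′` gives, ★ `OmegaHomBlockAlgebra` / road (P) of the cell's d6 line), through the generic ★
`HeckeFixedVectorsIntertwinersSemilinearLevelwise.exists_semilinear_intertwiner_extending_of_levelwise` (Bump 4.2.3 (b) without a
`G`-complement) at the family `𝓛` of small levels `K′ ≤ K` normalised by `K` (★ `C5.SmallLevel.exists_normal_le`).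

* §1 `exists_heckeStable_compl_fixedPoints_of_isSemisimpleModule` — at one small level `K′`: if `M_{K′}` is a semisimple `𝒜_{K′}`-module then every
  Hecke-stable subspace of `(ℚ̄_ℓ ⊗ H¹_ét(A_∞))^{K′} = range ([·]_{K′} ⊗ 1)` has a Hecke-stable complement there (transport along the injective
  `[·]_{K′} ⊗ 1`, ★ `range_toTower_baseChange_eq_fixedPoints`, ★ `toTower_baseChange_ops_eq_heckeOperator`).
* §2 `exists_mem_omegaHom_extending_of_levelwise`, `apply_mem_blockValues_of_heckeEquivariant_of_levelwise`,
  `map_fixedPoints_le_span_blockValues_of_levelwise` — the three theorems of ★ `OmegaHomIsotypic` with `[σ.IsSemisimpleRepresentation]` replaced by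
  the family hypothesis `hssM : ∀ K′, IsSemisimpleModule 𝒜_{K′} M_{K′}` (`σ = 1 ⊗ rhoEt` stays as the explicit, definition-free binder `(σ) (hσ)`).

Cell `hodgecm-mathlib` (d6 S2′, «S1c eliminator» (O-III)): with these, ★ `OmegaHomIsotypicComponent` and ★ `OmegaHomBlockFieldCharacter` (the socket
`SocketIso`) acquire σ-free twins whose only semisimplicity input is `∀ K′, IsSemisimpleRing (heckeImage K′)`.  Count-neutral; HC_CM is proved only
modulo the 7 printed citations until rung 0 closes.

## References
* [Liu2021] Y. Liu, *Fourier–Jacobi cycles and arithmetic relative trace formula*, Camb. J. Math. 9 (2021), p. 133 (D.3) (FJcycle.tex l. 5463–5470),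
  §4.2 (l. 2060–2074, 2158–2166), Thm. 4.18 (1) (l. 2239).
* [Bump1997] D. Bump, *Automorphic Forms and Representations* (1997), Prop. 4.2.3 (p. 427).
* [BushnellHenniart2006] C. J. Bushnell, G. Henniart, *The Local Langlands Conjecture for GL(2)* (2006), §4.2 Lemma (p. 35), §4.3 Proposition (2)
  (pp. 38–39).
-/

set_option autoImplicit false

noncomputable section

open CategoryTheory NumberField Function MulAction
open scoped TensorProduct

namespace Literature.NumberTheory.Automorphic.Liu2021.AppendixC

open Literature.AlgebraicGeometry.Motives (AbelianVariety)
open Literature.AlgebraicGeometry.Motives.AbelianVariety (rationalTateModuleMap endAlgebra rationalTateAction)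

variable {F E : Type} [Field F] [NumberField F] [IsTotallyReal F] [Field E] [NumberField E] [Algebra F E]
  [IsTotallyComplex E] [Algebra.IsQuadraticExtension F E]
variable {P5 : PropC5Data F E} {isotropicAt : ℕ → Prop}

namespace Sec42Data.HeckeTranslates

variable {C : Sec42Data P5 isotropicAt} (T : C.HeckeTranslates) (ℓ : ℕ) [Fact ℓ.Prime]
  (hI : ∀ ⦃K K' : C5.SmallLevel C.S.K₀⦄ (f : K' ⟶ K), Function.Injective (rationalTateModuleMap ℓ (C.Atr f)).dualMap)
  (X : C.EtaleHeckeDatum ℓ) (hX : X.rhoEt = T.etHeckeRep ℓ) (ι : ℂ ≃+* AlgebraicClosure ℚ_[ℓ])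
  {W : Type} [AddCommGroup W] [Module ℂ W] (ρW : Representation ℂ C.G W)
  (σ : Representation (AlgebraicClosure ℚ_[ℓ]) C.G (AlgebraicClosure ℚ_[ℓ] ⊗[ℚ_[ℓ]] C.etaleH1Tower ℓ))
  (hσ : ∀ g : C.G, σ g = (X.rhoEt g).baseChange (AlgebraicClosure ℚ_[ℓ]))

/-! ## §1 One level: Hecke-stable complements in `(ℚ̄_ℓ ⊗ H¹_ét(A_∞))^{K′}` from the semisimplicity of `ℚ̄_ℓ ⊗ H¹_ét(A_{K′})` over `𝒜_{K′}` -/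

include hI hX hσ in
/-- **Hecke-stable complements at level `K′` from `𝒜_{K′}`-semisimplicity.**  If `ℚ̄_ℓ ⊗ H¹_ét(A_{K′})` is a semisimple module over
`𝒜_{K′} = ℚ̄_ℓ[ᵗV_ℓ^ℚ(heckeEnd K′ g) ⊗ 1 : g]`, then every subspace of the `K′`-invariants of `σ = 1 ⊗ rhoEt` stable under all Hecke operators
`[K′gK′]` has a stable complement inside the `K′`-invariants (transport along `[·]_{K′} ⊗ 1`, an injective map onto the `K′`-invariants intertwining
`ᵗV_ℓ^ℚ(heckeEnd K′ g) ⊗ 1` with `[K′gK′]`). [cite: Liu2021, Thm. 4.18 (1) (FJcycle.tex l. 2239) and §4.2 (l. 2158–2166)] [cite: Bump1997, Prop. 4.2.3] -/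
theorem exists_heckeStable_compl_fixedPoints_of_isSemisimpleModule (hD : T.IsogenyDescent) (K' : C5.SmallLevel C.S.K₀)
    (S : Set (Module.End (AlgebraicClosure ℚ_[ℓ]) (AlgebraicClosure ℚ_[ℓ] ⊗[ℚ_[ℓ]] C.etaleH1 ℓ K')))
    (hS : S = Set.range fun g : C.G => ((rationalTateAction (C.A K') ℓ (T.heckeEnd hD K' g)).dualMap).baseChange (AlgebraicClosure ℚ_[ℓ]))
    (hss : IsSemisimpleModule ↥(Algebra.adjoin (AlgebraicClosure ℚ_[ℓ]) S) (AlgebraicClosure ℚ_[ℓ] ⊗[ℚ_[ℓ]] C.etaleH1 ℓ K'))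
    (N : Submodule (AlgebraicClosure ℚ_[ℓ]) (AlgebraicClosure ℚ_[ℓ] ⊗[ℚ_[ℓ]] C.etaleH1Tower ℓ))
    (hNK : N ≤ σ.fixedPoints (K'.1.1 : Subgroup C.G)) (hNst : ∀ g : C.G, ∀ n ∈ N, heckeOperator σ K'.1.1 g n ∈ N) :
    ∃ D : Submodule (AlgebraicClosure ℚ_[ℓ]) (AlgebraicClosure ℚ_[ℓ] ⊗[ℚ_[ℓ]] C.etaleH1Tower ℓ),
      D ≤ σ.fixedPoints (K'.1.1 : Subgroup C.G) ∧ (∀ g : C.G, ∀ d ∈ D, heckeOperator σ K'.1.1 g d ∈ D) ∧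
        N ⊓ D = ⊥ ∧ N ⊔ D = σ.fixedPoints (K'.1.1 : Subgroup C.G) := by
  classical
  have hσ' : ∀ g : C.G, σ g = (T.etHeckeRep ℓ g).baseChange (AlgebraicClosure ℚ_[ℓ]) := fun g => by rw [hσ, hX]
  obtain ⟨j, hj⟩ : ∃ j : (AlgebraicClosure ℚ_[ℓ] ⊗[ℚ_[ℓ]] C.etaleH1 ℓ K') →ₗ[AlgebraicClosure ℚ_[ℓ]] AlgebraicClosure ℚ_[ℓ] ⊗[ℚ_[ℓ]] C.etaleH1Tower ℓ,
      j = (C.toTower ℓ K').baseChange (AlgebraicClosure ℚ_[ℓ]) := ⟨_, rfl⟩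
  have hjinj : Function.Injective j := by
    rw [hj]
    exact toTower_baseChange_injective C ℓ (C.toTower_injective ℓ hI K')
  have hjK : LinearMap.range j = σ.fixedPoints (K'.1.1 : Subgroup C.G) := by
    rw [hj]
    exact T.range_toTower_baseChange_eq_fixedPoints ℓ K' hI σ hσ' hD
  have hjops : ∀ (s : Module.End (AlgebraicClosure ℚ_[ℓ]) (AlgebraicClosure ℚ_[ℓ] ⊗[ℚ_[ℓ]] C.etaleH1 ℓ K')), s ∈ S →
      ∃ g : C.G, ∀ z, j (s z) = heckeOperator σ K'.1.1 g (j z) := by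
    intro s hs
    rw [hS] at hs
    obtain ⟨g, rfl⟩ := hs
    refine ⟨g, fun z => ?_⟩
    rw [hj]
    exact T.toTower_baseChange_ops_eq_heckeOperator ℓ K' σ hσ' hD g z
  have hopsS : ∀ g : C.G, ((rationalTateAction (C.A K') ℓ (T.heckeEnd hD K' g)).dualMap).baseChange (AlgebraicClosure ℚ_[ℓ]) ∈ S := fun g => by
    rw [hS]; exact ⟨g, rfl⟩
  -- `N₀ := j⁻¹ N`, an `S`-stable subspace; a stable complement `C₀` from the semisimplicity over `𝒜_{K′}`
  have hN₀st : ∀ s ∈ S, ∀ z ∈ N.comap j, s z ∈ N.comap j := by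
    intro s hs z hz
    obtain ⟨g, hg⟩ := hjops s hs
    rw [Submodule.mem_comap] at hz ⊢
    rw [hg]
    exact hNst g _ hz
  haveI := hss
  obtain ⟨C₀, hC₀st, hc'⟩ := exists_stable_isCompl_of_isSemisimpleModule_adjoin (k := AlgebraicClosure ℚ_[ℓ]) S (N.comap j) hN₀st
  -- push forward along `j`
  refine ⟨C₀.map j, ?_, ?_, ?_, ?_⟩
  · rw [← hjK]
    exact LinearMap.map_le_range
  · rintro g _ ⟨z, hz, rfl⟩
    refine ⟨_, hC₀st _ (hopsS g) z hz, ?_⟩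
    rw [hj]
    exact T.toTower_baseChange_ops_eq_heckeOperator ℓ K' σ hσ' hD g z
  · rw [eq_bot_iff]
    rintro x ⟨hxN, ⟨z, hz, rfl⟩⟩
    have hz' : z ∈ N.comap j ⊓ C₀ := ⟨hxN, hz⟩
    rw [hc'.inf_eq_bot, Submodule.mem_bot] at hz'
    rw [Submodule.mem_bot, hz', map_zero]
  · refine le_antisymm (sup_le hNK (by rw [← hjK]; exact LinearMap.map_le_range)) fun y hy => ?_
    rw [← hjK] at hy
    obtain ⟨m, rfl⟩ := hy
    have hm : m ∈ N.comap j ⊔ C₀ := by rw [hc'.sup_eq_top]; exact Submodule.mem_top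
    obtain ⟨a, ha, b, hb, rfl⟩ := Submodule.mem_sup.1 hm
    rw [map_add]
    exact Submodule.add_mem_sup (Submodule.mem_comap.1 ha) ⟨b, hb, rfl⟩

/-! ## §2 Hecke-equivariant maps on `ω^K` extend to elements of the Hom-space — levelwise -/

include hI hX hσ in
/-- **Hecke-equivariant `ι`-semilinear maps on `ω^K` extend to elements of the Hom-space, from LEVELWISE semisimplicity** ([Liu2021] (D.3)
mechanism, levelwise; Bump 4.2.3 (b) without a `G`-complement, ★ `exists_semilinear_intertwiner_extending_of_levelwise` at the small levels
`K′ ≤ K` normalised by `K`): for `ρW` irreducible, `ℚ̄_ℓ ⊗ H¹_ét(A_{K′})` a semisimple `𝒜_{K′}`-module for every small `K′`, a small level `K` and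
`L : W →ₛₗ[ι] ℚ̄_ℓ ⊗ H¹_ét(A_∞)` with `L(ω^K) ⊆ (ℚ̄_ℓ ⊗ H¹)^K` and `L ([KgK] w) = (1 ⊗ [KgK]) (L w)` on `ω^K`, some `f ∈ X.omegaHom ι ρW` agrees with
`L` on `ω^K`. [cite: Liu2021, p. 133 (D.3) and §4.2 (FJcycle.tex l. 2060–2074)] [cite: Bump1997, Prop. 4.2.3]
[cite: BushnellHenniart2006, §4.3 Proposition (2) (pp. 38–39)] -/
theorem exists_mem_omegaHom_extending_of_levelwise (hD : T.IsogenyDescent) [ρW.IsIrreducible]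
    (hssM : ∀ K' : C5.SmallLevel C.S.K₀,
      IsSemisimpleModule ↥(Algebra.adjoin (AlgebraicClosure ℚ_[ℓ])
        ((Set.range fun g : C.G => ((rationalTateAction (C.A K') ℓ (T.heckeEnd hD K' g)).dualMap).baseChange (AlgebraicClosure ℚ_[ℓ])) :
          Set (Module.End (AlgebraicClosure ℚ_[ℓ]) (AlgebraicClosure ℚ_[ℓ] ⊗[ℚ_[ℓ]] C.etaleH1 ℓ K'))))
        (AlgebraicClosure ℚ_[ℓ] ⊗[ℚ_[ℓ]] C.etaleH1 ℓ K'))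
    (K : C5.SmallLevel C.S.K₀)
    (L : W →ₛₗ[(ι : ℂ →+* AlgebraicClosure ℚ_[ℓ])] AlgebraicClosure ℚ_[ℓ] ⊗[ℚ_[ℓ]] C.etaleH1Tower ℓ)
    (hLK : ∀ w ∈ ρW.fixedPoints (K.1.1 : Subgroup C.G), ∀ k ∈ (K.1.1 : Subgroup C.G),
      (X.rhoEt k).baseChange (AlgebraicClosure ℚ_[ℓ]) (L w) = L w)
    (hL : ∀ (g : C.G), ∀ w ∈ ρW.fixedPoints (K.1.1 : Subgroup C.G),
      L (heckeOperator ρW K.1.1 g w) = (heckeOperator X.rhoEt K.1.1 g).baseChange (AlgebraicClosure ℚ_[ℓ]) (L w)) :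
    ∃ f ∈ X.omegaHom ι ρW, ∀ w ∈ ρW.fixedPoints (K.1.1 : Subgroup C.G), f w = L w := by
  classical
  have hσ' : ∀ g : C.G, σ g = (T.etHeckeRep ℓ g).baseChange (AlgebraicClosure ℚ_[ℓ]) := fun g => by rw [hσ, hX]
  have hfin := Sec42Data.EtaleHeckeDatum.finite_orbit_smallLevel (C := C) K
  -- the family of small levels `K′ ≤ K` normalised by `K`
  obtain ⟨𝓛, h𝓛⟩ : ∃ 𝓛 : Set (Subgroup C.G), 𝓛 = {H | ∃ K' : C5.SmallLevel C.S.K₀, (K'.1.1 : Subgroup C.G) = H ∧ K' ≤ K ∧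
      ∀ c ∈ (K.1.1 : Subgroup C.G), C5.HeckeLE c K' K'} := ⟨_, rfl⟩
  have h𝓛K : ∀ K'' ∈ 𝓛, K'' ≤ (K.1.1 : Subgroup C.G) := by
    rintro _ hK''
    rw [h𝓛] at hK''
    obtain ⟨K', rfl, hle, -⟩ := hK''
    exact hle
  have h𝓛n : ∀ K'' ∈ 𝓛, ∀ c ∈ (K.1.1 : Subgroup C.G), ∀ x ∈ K'', c⁻¹ * x * c ∈ K'' := by
    rintro _ hK''
    rw [h𝓛] at hK''
    obtain ⟨K', rfl, -, hn⟩ := hK''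
    exact fun c hc x hx => hn c hc x hx
  have h𝓛fin : ∀ K'' ∈ 𝓛, ∀ g : C.G, (orbit K'' (g : C.G ⧸ K'')).Finite := by
    rintro _ hK''
    rw [h𝓛] at hK''
    obtain ⟨K', rfl, -, -⟩ := hK''
    exact Sec42Data.EtaleHeckeDatum.finite_orbit_smallLevel (C := C) K'
  -- every vector of the tower is fixed by such a level
  have hsm : ∀ v : AlgebraicClosure ℚ_[ℓ] ⊗[ℚ_[ℓ]] C.etaleH1Tower ℓ, ∃ K'' ∈ 𝓛, v ∈ σ.fixedPoints K'' := by
    intro v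
    obtain ⟨K₁, -, x, hx⟩ := exists_eq_toTower_baseChange C ℓ K v
    obtain ⟨N, hNK, hNK₁, hNn⟩ := C5.SmallLevel.exists_normal_le K K₁
    refine ⟨N.1.1, ?_, ?_⟩
    · rw [h𝓛]
      exact ⟨N, rfl, hNK, hNn⟩
    · have hv : v ∈ σ.fixedPoints (K₁.1.1 : Subgroup C.G) := by
        rw [← T.range_toTower_baseChange_eq_fixedPoints ℓ K₁ hI σ hσ' hD]
        exact ⟨x, hx⟩
      exact Representation.fixedPoints_antitone σ (show (N.1.1 : Subgroup C.G) ≤ K₁.1.1 from hNK₁) hv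
  -- levelwise Hecke-stable complements
  have hss : ∀ K'' ∈ 𝓛, ∀ N : Submodule (AlgebraicClosure ℚ_[ℓ]) (AlgebraicClosure ℚ_[ℓ] ⊗[ℚ_[ℓ]] C.etaleH1Tower ℓ), N ≤ σ.fixedPoints K'' →
      (∀ g : C.G, ∀ n ∈ N, heckeOperator σ K'' g n ∈ N) →
        ∃ D : Submodule (AlgebraicClosure ℚ_[ℓ]) (AlgebraicClosure ℚ_[ℓ] ⊗[ℚ_[ℓ]] C.etaleH1Tower ℓ), D ≤ σ.fixedPoints K'' ∧
          (∀ g : C.G, ∀ d ∈ D, heckeOperator σ K'' g d ∈ D) ∧ N ⊓ D = ⊥ ∧ N ⊔ D = σ.fixedPoints K'' := by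
    rintro _ hK''
    rw [h𝓛] at hK''
    obtain ⟨K', rfl, -, -⟩ := hK''
    intro N hNK hNst
    exact T.exists_heckeStable_compl_fixedPoints_of_isSemisimpleModule ℓ hI X hX σ hσ hD K' _ rfl (hssM K') N hNK hNst
  obtain ⟨f, hfG, hfL⟩ := exists_semilinear_intertwiner_extending_of_levelwise ι ρW σ (K.1.1 : Subgroup C.G) hfin 𝓛 h𝓛K h𝓛n h𝓛fin hsm hss L
    (fun w hw => by
      rw [Representation.mem_fixedPoints]
      intro k hk
      rw [hσ]
      exact hLK w hw k hk)
    (fun g w hw => by rw [hL g w hw, Sec42Data.EtaleHeckeDatum.heckeOperator_eq_baseChange_of_eq X σ hσ _ g (hfin g)])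
  exact ⟨f, Sec42Data.EtaleHeckeDatum.mem_omegaHom_of_forall_apply_eq X ι ρW σ hσ f hfG, hfL⟩

include hI hX hσ in
/-- **Hecke-equivariant images of `ω^K` consist of block values** (levelwise): under the hypotheses of `exists_mem_omegaHom_extending_of_levelwise`,
`L w` for `w ∈ ω^K` is a value of an element of `X.omegaHom ι ρW`. [cite: Liu2021, p. 133 (D.3)] [cite: Bump1997, Prop. 4.2.3] -/
theorem apply_mem_blockValues_of_heckeEquivariant_of_levelwise (hD : T.IsogenyDescent) [ρW.IsIrreducible]
    (hssM : ∀ K' : C5.SmallLevel C.S.K₀,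
      IsSemisimpleModule ↥(Algebra.adjoin (AlgebraicClosure ℚ_[ℓ])
        ((Set.range fun g : C.G => ((rationalTateAction (C.A K') ℓ (T.heckeEnd hD K' g)).dualMap).baseChange (AlgebraicClosure ℚ_[ℓ])) :
          Set (Module.End (AlgebraicClosure ℚ_[ℓ]) (AlgebraicClosure ℚ_[ℓ] ⊗[ℚ_[ℓ]] C.etaleH1 ℓ K'))))
        (AlgebraicClosure ℚ_[ℓ] ⊗[ℚ_[ℓ]] C.etaleH1 ℓ K'))
    (K : C5.SmallLevel C.S.K₀)
    (L : W →ₛₗ[(ι : ℂ →+* AlgebraicClosure ℚ_[ℓ])] AlgebraicClosure ℚ_[ℓ] ⊗[ℚ_[ℓ]] C.etaleH1Tower ℓ)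
    (hLK : ∀ w ∈ ρW.fixedPoints (K.1.1 : Subgroup C.G), ∀ k ∈ (K.1.1 : Subgroup C.G),
      (X.rhoEt k).baseChange (AlgebraicClosure ℚ_[ℓ]) (L w) = L w)
    (hL : ∀ (g : C.G), ∀ w ∈ ρW.fixedPoints (K.1.1 : Subgroup C.G),
      L (heckeOperator ρW K.1.1 g w) = (heckeOperator X.rhoEt K.1.1 g).baseChange (AlgebraicClosure ℚ_[ℓ]) (L w))
    {w : W} (hw : w ∈ ρW.fixedPoints (K.1.1 : Subgroup C.G)) :
    L w ∈ {y | ∃ f ∈ X.omegaHom ι ρW, ∃ w : W, f w = y} := by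
  obtain ⟨f, hf, hfL⟩ := T.exists_mem_omegaHom_extending_of_levelwise ℓ hI X hX ι ρW σ hσ hD hssM K L hLK hL
  exact ⟨f, hf, w, hfL w hw⟩

include hI hX hσ in
/-- **`L(ω^K) ⊆ span(block values)`** — levelwise form of ★ `map_fixedPoints_le_span_blockValues`. [cite: Liu2021, p. 133 (D.3)]
[cite: Bump1997, Prop. 4.2.3] -/
theorem map_fixedPoints_le_span_blockValues_of_levelwise (hD : T.IsogenyDescent) [ρW.IsIrreducible]
    (hssM : ∀ K' : C5.SmallLevel C.S.K₀,
      IsSemisimpleModule ↥(Algebra.adjoin (AlgebraicClosure ℚ_[ℓ])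
        ((Set.range fun g : C.G => ((rationalTateAction (C.A K') ℓ (T.heckeEnd hD K' g)).dualMap).baseChange (AlgebraicClosure ℚ_[ℓ])) :
          Set (Module.End (AlgebraicClosure ℚ_[ℓ]) (AlgebraicClosure ℚ_[ℓ] ⊗[ℚ_[ℓ]] C.etaleH1 ℓ K'))))
        (AlgebraicClosure ℚ_[ℓ] ⊗[ℚ_[ℓ]] C.etaleH1 ℓ K'))
    (K : C5.SmallLevel C.S.K₀)
    (L : W →ₛₗ[(ι : ℂ →+* AlgebraicClosure ℚ_[ℓ])] AlgebraicClosure ℚ_[ℓ] ⊗[ℚ_[ℓ]] C.etaleH1Tower ℓ)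
    (hLK : ∀ w ∈ ρW.fixedPoints (K.1.1 : Subgroup C.G), ∀ k ∈ (K.1.1 : Subgroup C.G),
      (X.rhoEt k).baseChange (AlgebraicClosure ℚ_[ℓ]) (L w) = L w)
    (hL : ∀ (g : C.G), ∀ w ∈ ρW.fixedPoints (K.1.1 : Subgroup C.G),
      L (heckeOperator ρW K.1.1 g w) = (heckeOperator X.rhoEt K.1.1 g).baseChange (AlgebraicClosure ℚ_[ℓ]) (L w)) :
    (ρW.fixedPoints (K.1.1 : Subgroup C.G)).map L ≤
      Submodule.span (AlgebraicClosure ℚ_[ℓ]) {y | ∃ f ∈ X.omegaHom ι ρW, ∃ w : W, f w = y} := by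
  rintro _ ⟨w, hw, rfl⟩
  exact Submodule.subset_span (T.apply_mem_blockValues_of_heckeEquivariant_of_levelwise ℓ hI X hX ι ρW σ hσ hD hssM K L hLK hL hw)

end Sec42Data.HeckeTranslates

end Literature.NumberTheory.Automorphic.Liu2021.AppendixC

end
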